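import Summits.QuantumFields.YangMills.Theorems.UnitScaleTiltProp7ClosedPlaqFibreMinimiser
import HarnessLib

/-!
# Route `UnitScaleTilt`, crux K1 «MinimiserStabilityRegPr» (stmt-QuantumFields-19200, skeleton v10), route (β) for `stub_existenceMinimalOrbit` — **THE PLAQUETTE∕DIVERGENCE SPLIT
# OF THE INTERIORITY SENTENCE OVER THE PLAQUETTE-ONLY CLOSED FIBRE `(6̄ₚ)(e) ∩ 𝔅_k(V)`** (twin of `UnitScaleTiltProp7ClosedFibreInteriorSplit` over `UnitScaleTiltProp7ClosedPlaqFibreMinimiser`)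

Cell `ym3-torus` (HUMAN RULING D-0037, YM ladder rung R3), width seat `ym-ust-20520-w4` (g0).  THEOREMS ONLY (0 `def`, 0 `sorry`, standard axioms).  For minimisers `Ū` of the
Wilson action over the plaquette-only closed fibre (no divergence constraint; only plaquette-shell KKT multipliers), (7)-data with a (14)-background, on a radius window
`L³B₃ε₁ ≤ e ≤ e₆`: PLAQₚ «every plaquette variable strictly inside `eL^{−2(K−n)}`» and DIVₚ «every covariant divergence (1.2) strictly inside `eL^{−3(K−n)}`» (here a
CONCLUSION about an unconstrained quantity, as Sect. F derives (1.9)-smallness from (158)); ★★ `existenceMinimalOrbit_of_plaqHalfP_divHalfP_allL : PLAQₚ_allL → DIVₚ_allL →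
⟨v10 `stub_existenceMinimalOrbit` TEXT VERBATIM⟩` at `O₁ = 1` via `existenceMinimalOrbit_of_plaqInterior_allL`.

HONEST FRAMING.  Glue only; PLAQₚ and DIVₚ stay hypotheses (the KKT∕halving estimate of [Balaban1985Variational] Sect. F with a sign); nothing of print asserted; no
stub∕crux∕count moves; YM₃ on T³ is ladder rung R3 — not d = 4, not a mass gap, not Clay.

References: T. Bałaban, CMP **102** (1985) 277–309 [Balaban1985Variational] ((2)–(8) p.278, (14) p.280, Prop. 7 p.299, Sect. F (158)–(165) pp.302–304).
-/

set_option autoImplicit false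

noncomputable section

namespace Summit.QuantumFields.YangMills.Theorems.Prop7ClosedFibreMinimiser

open Set
open scoped Matrix.Norms.L2Operator
open Literature.MathematicalPhysics.QuantumFieldTheory.Balaban1983to89
open Literature.MathematicalPhysics.QuantumFieldTheory.Balaban1983to89.T3ContinuumYM3Torus
open Literature.MathematicalPhysics.QuantumFieldTheory.Balaban1983to89.T3UnitLawDensityEML (ℰp)
open Literature.MathematicalPhysics.QuantumFieldTheory.Balaban1983to89.T3PrintedRegularMinimiser (RegPr DivSmall regFibrePr)
open Literature.MathematicalPhysics.QuantumFieldTheory.Balaban1983to89.T3RegularMinimiser (regThreshold)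
open Literature.MathematicalPhysics.QuantumFieldTheory.Balaban1983to89.T3ConstrainedMinimiser (fibre)
open Literature.MathematicalPhysics.QuantumFieldTheory.Balaban1983to89.T3TiltDescent (descendTo)
open Literature.MathematicalPhysics.QuantumFieldTheory.Balaban1983to89.B10Eq27TorusAxialLog (toUField unitsField)
open Literature.MathematicalPhysics.QuantumFieldTheory.Balaban1983to89.B10Eq68TorusRegularity (covDivT)

/-! ## EX from the two plaquette-fibre halves on a window, at `O₁ = 1` -/

/-- ★★ **v10's `stub_existenceMinimalOrbit` ⇐ PLAQₚ_allL ∧ DIVₚ_allL** (minimisers over the PLAQUETTE-ONLY closed fibre): read both halves at `e := L³B₃ε₁` (`O₁ = 1`), shrink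
`a′₁` to fit both windows, conclude `RegPr (L³B₃ε₁) Ū` and apply `existenceMinimalOrbit_of_plaqInterior_allL`.
[cite: Balaban1985Variational, Prop. 7 p.299, (14) p.280, Sect. F (158)-(165) pp.302-304] -/
theorem existenceMinimalOrbit_of_plaqHalfP_divHalfP_allL
    (hP : ∀ L : ℕ, 1 < L → ∀ B₃ : ℝ, 4 < B₃ → ∃ e₆ a₁' : ℝ, 0 < e₆ ∧ 0 < a₁' ∧
      ∀ F : T3Family, F.L = L → ∀ (n K : ℕ) (hnK : n < K) (ε₁ : ℝ), 0 < ε₁ → ε₁ ≤ a₁' → ∀ e : ℝ, (L : ℝ) ^ 3 * B₃ * ε₁ ≤ e → e ≤ e₆ →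
        ∀ V : GaugeField (F.P n) 0 (Matrix.specialUnitaryGroup (Fin 2) ℂ), PlaqSmall ε₁ V →
          ∀ U₀ : GaugeField (F.P K) 0 (Matrix.specialUnitaryGroup (Fin 2) ℂ), RegPr F n K ((L : ℝ) ^ 3 * B₃ * ε₁) U₀ →
            U₀ ∈ fibre F ℰp n K hnK.le V →
            ∀ Ū : GaugeField (F.P K) 0 (Matrix.specialUnitaryGroup (Fin 2) ℂ),
              Ū ∈ {U : GaugeField (F.P K) 0 (Matrix.specialUnitaryGroup (Fin 2) ℂ) | ∀ p : Plaq (F.P K) 0,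
                    GaugeGroup.dist1 (GaugeField.plaqHol U p) ≤ regThreshold F n K e} ∩ descendTo F ℰp n K hnK.le ⁻¹' {V} →
              IsMinOn (fun W : GaugeField (F.P K) 0 (Matrix.specialUnitaryGroup (Fin 2) ℂ) => wilsonAction4 W)
                ({U : GaugeField (F.P K) 0 (Matrix.specialUnitaryGroup (Fin 2) ℂ) | ∀ p : Plaq (F.P K) 0,
                    GaugeGroup.dist1 (GaugeField.plaqHol U p) ≤ regThreshold F n K e} ∩ descendTo F ℰp n K hnK.le ⁻¹' {V}) Ū →
              PlaqSmall (regThreshold F n K e) Ū)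
    (hD : ∀ L : ℕ, 1 < L → ∀ B₃ : ℝ, 4 < B₃ → ∃ e₆ a₁' : ℝ, 0 < e₆ ∧ 0 < a₁' ∧
      ∀ F : T3Family, F.L = L → ∀ (n K : ℕ) (hnK : n < K) (ε₁ : ℝ), 0 < ε₁ → ε₁ ≤ a₁' → ∀ e : ℝ, (L : ℝ) ^ 3 * B₃ * ε₁ ≤ e → e ≤ e₆ →
        ∀ V : GaugeField (F.P n) 0 (Matrix.specialUnitaryGroup (Fin 2) ℂ), PlaqSmall ε₁ V →
          ∀ U₀ : GaugeField (F.P K) 0 (Matrix.specialUnitaryGroup (Fin 2) ℂ), RegPr F n K ((L : ℝ) ^ 3 * B₃ * ε₁) U₀ →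
            U₀ ∈ fibre F ℰp n K hnK.le V →
            ∀ Ū : GaugeField (F.P K) 0 (Matrix.specialUnitaryGroup (Fin 2) ℂ),
              Ū ∈ {U : GaugeField (F.P K) 0 (Matrix.specialUnitaryGroup (Fin 2) ℂ) | ∀ p : Plaq (F.P K) 0,
                    GaugeGroup.dist1 (GaugeField.plaqHol U p) ≤ regThreshold F n K e} ∩ descendTo F ℰp n K hnK.le ⁻¹' {V} →
              IsMinOn (fun W : GaugeField (F.P K) 0 (Matrix.specialUnitaryGroup (Fin 2) ℂ) => wilsonAction4 W)
                ({U : GaugeField (F.P K) 0 (Matrix.specialUnitaryGroup (Fin 2) ℂ) | ∀ p : Plaq (F.P K) 0,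
                    GaugeGroup.dist1 (GaugeField.plaqHol U p) ≤ regThreshold F n K e} ∩ descendTo F ℰp n K hnK.le ⁻¹' {V}) Ū →
              DivSmall F n K e Ū) :
    ∀ L : ℕ, 1 < L → ∀ B₃ : ℝ, 4 < B₃ → ∃ a₁' O₁ : ℝ, 0 < a₁' ∧ 1 ≤ O₁ ∧
      ∀ F : T3Family, F.L = L → ∀ (n K : ℕ) (hnK : n < K) (ε₁ : ℝ), 0 < ε₁ →
        ∀ V : GaugeField (F.P n) 0 (Matrix.specialUnitaryGroup (Fin 2) ℂ), PlaqSmall ε₁ V →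
          ∀ U₀ : GaugeField (F.P K) 0 (Matrix.specialUnitaryGroup (Fin 2) ℂ), RegPr F n K ((L : ℝ) ^ 3 * B₃ * ε₁) U₀ →
            U₀ ∈ fibre F ℰp n K hnK.le V → ε₁ ≤ a₁' →
              ∃ U ∈ regFibrePr F n K hnK.le (O₁ * (L : ℝ) ^ 3 * B₃ * ε₁) V,
                IsMinOn (fun W : GaugeField (F.P K) 0 (Matrix.specialUnitaryGroup (Fin 2) ℂ) => wilsonAction4 W)
                  (regFibrePr F n K hnK.le (O₁ * (L : ℝ) ^ 3 * B₃ * ε₁) V) U := by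
  refine existenceMinimalOrbit_of_plaqInterior_allL fun L hL B₃ hB₃ => ?_
  obtain ⟨eP, aP, heP, haP, hP⟩ := hP L hL B₃ hB₃
  obtain ⟨eD, aD, heD, haD, hD⟩ := hD L hL B₃ hB₃
  have hLpos : (0 : ℝ) < L := by exact_mod_cast (by omega : 0 < L)
  have hB₃pos : 0 < B₃ := by linarith
  have hDpos : 0 < (L : ℝ) ^ 3 * B₃ := by positivity
  -- `a″₁ := min (min aP aD) (min eP eD / (L³B₃))`, `O₁ := 1`
  set a₁'' : ℝ := min (min aP aD) (min eP eD / ((L : ℝ) ^ 3 * B₃)) with ha''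
  have ha₁'' : 0 < a₁'' := lt_min (lt_min haP haD) (div_pos (lt_min heP heD) hDpos)
  refine ⟨a₁'', 1, ha₁'', le_rfl, fun F hF n K hnK ε₁ hε₁ hε₁a V hV U₀ hreg hfib Ū hŪ hmin => ?_⟩
  have haP' : ε₁ ≤ aP := hε₁a.trans ((min_le_left _ _).trans (min_le_left _ _))
  have haD' : ε₁ ≤ aD := hε₁a.trans ((min_le_left _ _).trans (min_le_right _ _))
  have hwin : (L : ℝ) ^ 3 * B₃ * ε₁ ≤ min eP eD := by
    have : ε₁ ≤ min eP eD / ((L : ℝ) ^ 3 * B₃) := hε₁a.trans (min_le_right _ _)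
    rw [le_div_iff₀ hDpos] at this
    linarith [this]
  have h1 : (1 : ℝ) * (L : ℝ) ^ 3 * B₃ * ε₁ = (L : ℝ) ^ 3 * B₃ * ε₁ := by ring
  rw [h1] at hŪ hmin ⊢
  exact ⟨hP F hF n K hnK ε₁ hε₁ haP' _ le_rfl (hwin.trans (min_le_left _ _)) V hV U₀ hreg hfib Ū hŪ hmin,
    hD F hF n K hnK ε₁ hε₁ haD' _ le_rfl (hwin.trans (min_le_right _ _)) V hV U₀ hreg hfib Ū hŪ hmin⟩

end Summit.QuantumFields.YangMills.Theorems.Prop7ClosedFibreMinimiser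

end
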